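import Summits.QuantumFields.BalabanUV.T4Continuum.Support.NE7DirIterL1LetterAt
import Summits.QuantumFields.BalabanUV.T4Continuum.Support.NE3QuadRemainderSup
import Summits.QuantumFields.BalabanUV.T4Continuum.Spine.NE3.RemainderL1TowerB8
import HarnessLib

/-!
# Support | NE7 (gen 95, brick (S2)-B4): THE ℓ¹ TELESCOPE OF THE k-FOLD QUADRATIC REMAINDER — `dirL1 (relIter K W X − dirIter K W X) (periodBox N)
# ≤ C₁ · Σ_{j<K} dirL1 (E_j) (periodBox (L^{K−1−j}·N))`, `C₁ = 3 + 12d²L(2nbRad+1)^d` k-FREE, `E_j` the one-step remainders of the tower (global frame bound)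

Cell `pub-balaban`, rung (B)+1 sub-cell t4, lineage `b2b-balaban-t4-ne7-p1` (CRUX PROVER NE7 #1 = OWNER of row NE7), generation 95.  The ℓ¹ twin of Π-C-3b's sup telescope
`NE3QuadRemainderSup.norm_relIter_sub_dirIter_le` (same induction, same hypotheses), with Π-C-3a's sup letter of the partial linear towers replaced by F332's ℓ¹ letter
`NE7DirIterL1LetterAt.dirL1_dirIter_le_at`; the one-step remainders are NOT estimated here (they stay as `dirL1` of `relStep − cpush` at each level), so that the successor may
feed ANY local bound (sup², ends-form at corner chains, …) into the right-hand side.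
RELATED (located after writing): the `pub-balaban-gaps` ne3 seat's `Spine/NE3/RemainderL1TowerB8` (ℓ¹ tower of `QbarIter` on B8's surface, census R26′) and
`RemainderSumsStepB8` (one-step remainder in ℓ¹∕ℓ² from sup²) — on B8's surface the linear tower has NO frame part, which is why R26′ closes there.
WHY.  Step one of (S2) (memo WEIGHT-CURRENCY-DEAD §7): the direct ℓ¹ letter `dirL1(D X) ≤ q₁‖X‖_w²` of the fibre element is the ℓ¹ size of the quadratic remainder; this file reduces
it, k-uniformly, to the ℓ¹ sizes of the one-step remainders.  HONEST LIMIT: the frame part is bounded here GLOBALLY (F329's `sum_norm_framePotW_le`), so bulk remainders are NOT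
contracted — the SHARP form (straight part contracted by `(L∕L^d)^{K−1−j}`, frame part read only in the corner boxes, F329 v2 `sum_norm_framePotW_le_boxes`) is the successor's
next file; for corner-localised remainders the present form is already sharp.
WHAT ([folklore]; 0 def, 0 sorry).  **`dirL1_relIter_sub_dirIter_le`**: tower class + sup regime of Π-C-3b (`4(3+12d)²L^K s ≤ rho0²`) + the ℓ¹ curvature line ⟹ for every `k ≤ K`,
`dirL1 (R_k) (periodBox (L^{K−k}N)) ≤ (3 + 12d²L(2nbRad+1)^d)·Σ_{j<k} dirL1 (E_j) (periodBox (L^{K−1−j}N))`.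
HONEST FRAMING (page 1): bookkeeping over landed letters; nothing of Bałaban's asserted; the energy letters and `hdecomp` are NOT here; NE7 NOT PROVED; spine 0∕9; finite T⁴ rung (B)+1 — NOT infinite
volume, NOT mass gap, NOT `BetaPertH`, NOT Clay.  Continuum YM on T⁴ ⇐ BetaPertH ∧ nine spine estimates (0/9 proved); BetaPertH ⇐ (D1) ∧ (D4) ∧ CAP+tail; G-an2-4 gates asym, D1 and NE2/3/4.
-/

set_option autoImplicit false

open scoped BigOperators Matrix.Norms.L2Operator
open Finset

namespace Summit.QuantumFields.BalabanUV.T4Continuum.NE7QuadRemainderL1Telescope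

open Literature.MathematicalPhysics.QuantumFieldTheory.Balaban1983to89
open B7Prop1Explicit B7Prop2Explicit
open T4AveragingDeficitWall (IsUnitaryCfg IsSkewDir SmallField dirL1)
open T4AveragingDeficitWallBoundary (IsPeriodicCfg periodBox)
open AveragingDeficitPeriodicCounting (IsPeriodicDir)
open AveragingDeficitMultiLevelPrep (cpush cavgIter radIter LevelSmall)
open AveragingDeficitDerivCore (dirL1_nonneg)
open BlockAverageVaryHolo (nbRad)
open BlockAverageVaryDisc (rho0 rho0_pos)
open NE3TangentCovariantTower (dirIter dirIter_zero)
open NE3LinearisedAverageSup (curvSum)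
open NE3QuadRemainderTower (relStep relIter relIter_zero dirIter_push_telescope)
open NE3QuadRemainderLevels (levelPkg level_remainder)
open NE3QuadRemainderSup (sigma_lines norm_relIter_le relIter_skew_of_tower)
open NE7DirIterL1LetterAt (dirL1_dirIter_le_at l1Const_le)
open NE3.RemainderL1TowerB8 (dirL1_add_le')

noncomputable section
variable {d : ℕ} {n : Type*} [Fintype n] [DecidableEq n]

/-- **THE ℓ¹ TELESCOPE OF THE k-FOLD QUADRATIC REMAINDER, k-FREE** (hypotheses = Π-C-3b's `norm_relIter_sub_dirIter_le` + the ℓ¹ curvature line): for every `k ≤ K`,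
`dirL1 (relIter k − dirIter k) (periodBox (L^{K−k}·N)) ≤ (3 + 12d²L(2nbRad+1)^d)·Σ_{j<k} dirL1 (relStep W_j X_j − cpush W_j X_j) (periodBox (L^{K−1−j}·N))`,
`W_j = cavgIter L j W`, `X_j = relIter L j W X`. [folklore] -/
theorem dirL1_relIter_sub_dirIter_le [Nonempty n] {L N K : ℕ} [NeZero N] (hL : 2 ≤ L) (hLd : 2 * (L : ℝ) ≤ (L : ℝ) ^ d)
    {W : Site d → Fin d → (Matrix n n ℂ)ˣ} {x : ℝ}
    (hWu : IsUnitaryCfg W) (hWP : IsPeriodicCfg W ((L ^ K * N : ℕ) : ℤ)) (hx : 0 ≤ x) (hsm : LevelSmall d L K x) (hWx : SmallField W x)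
    (hA : curvSum d L K x ≤ 2 / 3 * L) (hA1 : ((L : ℝ) ^ d / L * (d * (2 * nbRad d L + 1) ^ d)) * curvSum d L K x ≤ 2 / 3)
    {X : Site d → Fin d → Matrix n n ℂ} (hXs : IsSkewDir X) (hXP : IsPeriodicDir X ((L ^ K * N : ℕ) : ℤ))
    {s : ℝ} (hs : 0 ≤ s) (hX : ∀ (z : Site d) (μ : Fin d), ‖X z μ‖ ≤ s)
    (hσ : 4 * (3 + 12 * (d : ℝ)) ^ 2 * (L : ℝ) ^ K * s ≤ rho0 d L ^ 2) :
    ∀ k : ℕ, k ≤ K →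
      dirL1 (fun z κ => relIter L k W X z κ - dirIter L k W X z κ) (periodBox (d := d) (L ^ (K - k) * N))
        ≤ (3 + 12 * (d : ℝ) ^ 2 * L * (2 * nbRad d L + 1) ^ d)
          * ∑ j ∈ range k, dirL1 (fun z κ => relStep L (cavgIter L j W) (relIter L j W X) z κ - cpush L (cavgIter L j W) (relIter L j W X) z κ)
              (periodBox (d := d) (L ^ (K - 1 - j) * N)) := by
  have hL1 : 1 ≤ L := by omega
  have hρ : 0 < rho0 d L := rho0_pos (d := d) hL1
  set C₁ : ℝ := 3 + 12 * (d : ℝ) ^ 2 * L * (2 * nbRad d L + 1) ^ d with hC₁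
  have hC₁0 : 0 ≤ C₁ := by positivity
  intro k hk
  -- the sup data of Π-C-3b at every level (skewness, the disc)
  have hsup : ∀ i ≤ K, ∀ (z : Site d) (μ : Fin d), ‖relIter L i W X z μ‖ ≤ 2 * (3 + 12 * (d : ℝ)) * (L : ℝ) ^ i * s :=
    fun i hi => norm_relIter_le hL hWu hWP hx hsm hWx hA hXs hXP hs hX hσ hi
  have hskew : ∀ i ≤ K, IsSkewDir (relIter L i W X) := fun i hi => relIter_skew_of_tower hL hWu hWP hx hsm hWx hA hXs hXP hs hX hσ hi
  -- the one-step remainders `E_i`, `i < K`: skew, `(L^{K-i-1}N)`-periodic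
  have hE : ∀ i < K,
      IsSkewDir (fun z κ => relStep L (cavgIter L i W) (relIter L i W X) z κ - cpush L (cavgIter L i W) (relIter L i W X) z κ)
        ∧ IsPeriodicDir (fun z κ => relStep L (cavgIter L i W) (relIter L i W X) z κ - cpush L (cavgIter L i W) (relIter L i W X) z κ)
            ((L ^ (K - i - 1) * N : ℕ) : ℤ) := by
    intro i hi
    obtain ⟨-, h2, h3, -⟩ := level_remainder hL1 hWu hWP hx hsm hWx hA hi hXP (hskew i hi.le)
      (t := 2 * (3 + 12 * (d : ℝ)) * (L : ℝ) ^ i * s) (by positivity) (hsup i hi.le) (sigma_lines (d := d) hL hs hσ (i := i) hi.le).1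
    exact ⟨h2, h3⟩
  rcases k with _ | k'
  · have e : (fun z κ => relIter L 0 W X z κ - dirIter L 0 W X z κ) = fun _ _ => (0 : Matrix n n ℂ) := by
      funext z κ; rw [relIter_zero, dirIter_zero, sub_self]
    rw [e, Finset.sum_range_zero, mul_zero]
    unfold dirL1; simp
  · -- abbreviations
    have hterm : ∀ j : ℕ, j ≤ k' →
        dirL1 (dirIter L (k' - j) (cavgIter L (j + 1) W)
            (fun y μ => relStep L (cavgIter L j W) (relIter L j W X) y μ - cpush L (cavgIter L j W) (relIter L j W X) y μ))
          (periodBox (d := d) (L ^ (K - (k' + 1)) * N))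
        ≤ C₁ * dirL1 (fun z κ => relStep L (cavgIter L j W) (relIter L j W X) z κ - cpush L (cavgIter L j W) (relIter L j W X) z κ)
              (periodBox (d := d) (L ^ (K - 1 - j) * N)) := by
      intro j hj
      obtain ⟨h2, h3⟩ := hE j (by omega)
      have him : (j + 1) + (k' - j) ≤ K := by omega
      have h3' : IsPeriodicDir (fun z κ => relStep L (cavgIter L j W) (relIter L j W X) z κ - cpush L (cavgIter L j W) (relIter L j W X) z κ)
          ((L ^ (K - (j + 1)) * N : ℕ) : ℤ) := by rw [show K - (j + 1) = K - j - 1 by omega]; exact h3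
      have h := dirL1_dirIter_le_at hL hWu hWP hx hsm hWx hA hA1 him h2 h3'
      rw [show K - (j + 1) - (k' - j) = K - (k' + 1) by omega, show K - (j + 1) = K - 1 - j by omega] at h
      refine h.trans (mul_le_mul_of_nonneg_right (l1Const_le (d := d) hL1 hLd (k' - j)) (dirL1_nonneg _ _))
    -- the telescope pushed to the target level `k'+1`, in ℓ¹
    have hQ : ∀ j : ℕ, j ≤ k' →
        dirL1 (dirIter L (k' - j) (cavgIter L (j + 1) W) (fun y μ => relIter L (j + 1) W X y μ - dirIter L (j + 1) W X y μ))
            (periodBox (d := d) (L ^ (K - (k' + 1)) * N))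
          ≤ C₁ * ∑ i ∈ range (j + 1), dirL1 (fun z κ => relStep L (cavgIter L i W) (relIter L i W X) z κ - cpush L (cavgIter L i W) (relIter L i W X) z κ)
              (periodBox (d := d) (L ^ (K - 1 - i) * N)) := by
      intro j
      induction j with
      | zero =>
          intro _
          rw [Nat.sub_zero, Finset.sum_range_one]
          exact (le_of_eq (by rfl)).trans ((hterm 0 (by omega)).trans (le_of_eq (by rw [Nat.sub_zero])))
      | succ j ihj =>
          intro hj
          obtain ⟨hU1, hr1, hS1, -, h5121, -, -⟩ := levelPkg hL1 hWu hWP hx hsm hWx hA (i := j + 1) (by omega)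
          obtain ⟨hU2, hr2, hS2, -, -, hls2, -⟩ := levelPkg hL1 hWu hWP hx hsm hWx hA (i := j + 1 + 1) (by omega)
          have hsm2 : k' - (j + 1) = 0 ∨ LevelSmall d L (k' - (j + 1) - 1) (radIter d L (j + 1 + 1) x) := by
            rcases Nat.eq_zero_or_pos (k' - (j + 1)) with h0 | hpos
            · exact Or.inl h0
            · exact Or.inr (hls2 (k' - (j + 1)) (by omega) hpos)
          have hpt : (fun z κ => dirIter L (k' - (j + 1)) (cavgIter L (j + 1 + 1) W)
                (fun y μ => relIter L (j + 1 + 1) W X y μ - dirIter L (j + 1 + 1) W X y μ) z κ)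
              = fun z κ => dirIter L (k' - (j + 1)) (cavgIter L (j + 1 + 1) W)
                  (fun y μ => relStep L (cavgIter L (j + 1) W) (relIter L (j + 1) W X) y μ - cpush L (cavgIter L (j + 1) W) (relIter L (j + 1) W X) y μ) z κ
                + dirIter L (k' - j) (cavgIter L (j + 1) W) (fun y μ => relIter L (j + 1) W X y μ - dirIter L (j + 1) W X y μ) z κ := by
            funext z κ
            rw [dirIter_push_telescope hL1 (j + 1) (k' - (j + 1)) hU1 hr1 h5121 hS1 hU2 hr2 hsm2 hS2 X z κ,
              show k' - (j + 1) + 1 = k' - j by omega]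
          have hfirst := hterm (j + 1) hj
          have hsecond := ihj (by omega)
          calc dirL1 (dirIter L (k' - (j + 1)) (cavgIter L (j + 1 + 1) W) (fun y μ => relIter L (j + 1 + 1) W X y μ - dirIter L (j + 1 + 1) W X y μ))
                (periodBox (d := d) (L ^ (K - (k' + 1)) * N))
              = dirL1 (fun z κ => dirIter L (k' - (j + 1)) (cavgIter L (j + 1 + 1) W)
                  (fun y μ => relStep L (cavgIter L (j + 1) W) (relIter L (j + 1) W X) y μ - cpush L (cavgIter L (j + 1) W) (relIter L (j + 1) W X) y μ) z κ
                + dirIter L (k' - j) (cavgIter L (j + 1) W) (fun y μ => relIter L (j + 1) W X y μ - dirIter L (j + 1) W X y μ) z κ)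
                (periodBox (d := d) (L ^ (K - (k' + 1)) * N)) := by rw [← hpt]
            _ ≤ _ := dirL1_add_le' _ _ _
            _ ≤ C₁ * dirL1 (fun z κ => relStep L (cavgIter L (j + 1) W) (relIter L (j + 1) W X) z κ - cpush L (cavgIter L (j + 1) W) (relIter L (j + 1) W X) z κ)
                    (periodBox (d := d) (L ^ (K - 1 - (j + 1)) * N))
                + C₁ * ∑ i ∈ range (j + 1), dirL1 (fun z κ => relStep L (cavgIter L i W) (relIter L i W X) z κ - cpush L (cavgIter L i W) (relIter L i W X) z κ)
                    (periodBox (d := d) (L ^ (K - 1 - i) * N)) := add_le_add hfirst hsecond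
            _ = C₁ * ∑ i ∈ range (j + 1 + 1), dirL1 (fun z κ => relStep L (cavgIter L i W) (relIter L i W X) z κ - cpush L (cavgIter L i W) (relIter L i W X) z κ)
                    (periodBox (d := d) (L ^ (K - 1 - i) * N)) := by
                rw [Finset.sum_range_succ _ (j + 1), mul_add, add_comm]
    have h := hQ k' le_rfl
    rw [Nat.sub_self, dirIter_zero] at h
    exact h

end

end Summit.QuantumFields.BalabanUV.T4Continuum.NE7QuadRemainderL1Telescope
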